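import Literature.Analysis.FluidPDE.TaoLocalisedEnstrophy
import Literature.Analysis.FluidPDE.VorticityStretching
import Literature.Analysis.FluidPDE.LipschitzCutoffIBP
import Literature.Analysis.FluidPDE.WholeSpaceIBP
import HarnessLib

/-!
# Tao (2011/2013), proof of Thm. 10.1: the enstrophy identity against a Lipschitz cutoff

The dynamic half of Tao's enstrophy identity (10.11) (arXiv:1108.1165, p. 31): for a classical
Navier–Stokes solution on the closed slab `[0, T] × ℝ³` and a **Lipschitz, compactly supported**
weight `η` ("Integrating this equation against the Lipschitz, compactly supported `η` and
integrating by parts as in Section 8 (interpreting derivatives of `η` in a distributional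
sense)"), the production `∫ ⟨ω, ∂ₜω⟩ η` (`NS.enstrophyProduction`, `TaoLocalisedEnstrophy.lean`)
equals

  `−ν ∫ |∇ω|²_F η  −  ν Σⱼ ∫ ⟨ω, ∂ⱼω⟩ ∂ⱼη  +  ½ ∫ |ω|² (u·∇η)  +  ∫ ⟨ω, (ω·∇)u⟩ η  +  ∫ ⟨ω, curl f⟩ η`
  `=  −Y₁  +  Y₃  +  Y₄  +  Y₆  +  Y₅`     (`ν = 1` in Tao),

where `∂ⱼη`, `u·∇η` are directional (line) derivatives of `η`, defined a.e. (Rademacher). The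
ingredients: the stretching form of the vorticity equation `curl ∂ₜu = νΔω − (u·∇)ω + (ω·∇)u +
curl f` (`VorticityStretching.lean`), the pointwise identities `⟨ω, Δω⟩ = Σⱼ ∂ⱼ⟨ω, ∂ⱼω⟩ − |∇ω|²_F`
and `⟨ω, (u·∇)ω⟩ = ½ u·∇|ω|²`, and integration by parts against Lipschitz compactly supported
weights (`LipschitzCutoffIBP.lean`), applied with the weights `η` (viscous term) and `uⱼη`
(transport term, where `Σⱼ ∂ⱼ(uⱼη) = (div u) η + u·∇η = u·∇η`).

## References

* T. Tao, arXiv:1108.1165 (`Tao2011`), §10, proof of Thm. 10.1 ((10.11)–(10.14) and the terms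
  `Y₁, …, Y₆`, arXiv p. 31).
-/

noncomputable section

open MeasureTheory Set Function Filter Topology Metric InnerProductSpace
open scoped RealInnerProductSpace NNReal Laplacian ContDiff

namespace Literature.Analysis.FluidPDE

/-- Local notation for physical space `ℝ³ = EuclideanSpace ℝ (Fin 3)`. -/
local notation "ℝ³" => EuclideanSpace ℝ (Fin 3)

/-- Local notation for the standard basis vectors. -/
local notation "𝐞" j => EuclideanSpace.single (j : Fin 3) (1 : ℝ)

/-! ## Lipschitz weights: products with `C¹` functions, a.e. linearity of line derivatives -/

/-- A `C¹` function times a Lipschitz compactly supported weight is Lipschitz (truncate the `C¹`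
factor by a bump equal to `1` near the support of the weight). [folklore] -/
theorem exists_lipschitzWith_mul_of_contDiff {F η : ℝ³ → ℝ} (hF : ContDiff ℝ 1 F) {C : ℝ≥0}
    (hη : LipschitzWith C η) (hηc : HasCompactSupport η) :
    ∃ D : ℝ≥0, LipschitzWith D fun x => F x * η x := by
  obtain ⟨R, hR⟩ := hηc.isCompact.isBounded.subset_closedBall (0 : ℝ³)
  have hsub : tsupport η ⊆ closedBall (0 : ℝ³) (max R 0) :=
    hR.trans (closedBall_subset_closedBall (le_max_left _ _))
  let χ : ContDiffBump (0 : ℝ³) := ⟨max R 0 + 1, max R 0 + 2, by positivity, by linarith⟩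
  have hf1 : ContDiff ℝ 1 fun y => χ y * F y := (χ.contDiff (n := 1)).mul hF
  have hfc : HasCompactSupport fun y => χ y * F y := χ.hasCompactSupport.mul_right
  obtain ⟨D₁, hD₁⟩ := hf1.lipschitzWith_of_hasCompactSupport hfc one_ne_zero
  obtain ⟨B₁, hB₁⟩ := (hfc.isCompact).exists_bound_of_continuousOn (hf1.continuous.continuousOn)
  obtain ⟨B₂, hB₂⟩ := (hηc.isCompact).exists_bound_of_continuousOn (hη.continuous.continuousOn)
  -- `F η = (χ F) η` everywhere
  have heq : (fun x => F x * η x) = fun x => (χ x * F x) * η x := by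
    funext x
    by_cases hx : η x = 0
    · rw [hx, mul_zero, mul_zero]
    · have hxs : x ∈ closedBall (0 : ℝ³) (max R 0) := hsub (subset_tsupport _ hx)
      rw [χ.one_of_mem_closedBall (closedBall_subset_closedBall (by linarith) hxs), one_mul]
  rw [heq]
  -- Lipschitz estimate for a product of bounded Lipschitz functions
  have hb1 : ∀ x, ‖χ x * F x‖ ≤ max B₁ 0 := fun x => by
    by_cases hx : x ∈ tsupport fun y => χ y * F y
    · exact (hB₁ x hx).trans (le_max_left _ _)
    · rw [image_eq_zero_of_notMem_tsupport hx, norm_zero]; exact le_max_right _ _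
  have hb2 : ∀ x, ‖η x‖ ≤ max B₂ 0 := fun x => by
    by_cases hx : x ∈ tsupport η
    · exact (hB₂ x hx).trans (le_max_left _ _)
    · rw [image_eq_zero_of_notMem_tsupport hx, norm_zero]; exact le_max_right _ _
  refine ⟨Real.toNNReal (max B₁ 0 * C + max B₂ 0 * D₁), LipschitzWith.of_dist_le_mul fun x y => ?_⟩
  rw [Real.coe_toNNReal _ (by positivity), Real.dist_eq]
  have h1 := hη.dist_le_mul x y
  have h2 := hD₁.dist_le_mul x y
  rw [Real.dist_eq] at h1 h2
  calc |χ x * F x * η x - χ y * F y * η y|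
      = |χ x * F x * (η x - η y) + (χ x * F x - χ y * F y) * η y| := by ring_nf
    _ ≤ |χ x * F x| * |η x - η y| + |χ x * F x - χ y * F y| * |η y| := by
        rw [← abs_mul, ← abs_mul]; exact abs_add_le _ _
    _ ≤ max B₁ 0 * (C * dist x y) + D₁ * dist x y * max B₂ 0 := by
        have e1 := hb1 x; have e2 := hb2 y
        rw [Real.norm_eq_abs] at e1 e2
        exact add_le_add (mul_le_mul e1 h1 (abs_nonneg _) (le_max_right _ _))
          (mul_le_mul h2 e2 (abs_nonneg _) (by positivity))
    _ = (max B₁ 0 * C + max B₂ 0 * D₁) * dist x y := by ring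

/-- At a point where the Lipschitz weight is differentiable (a.e., Rademacher), its line
derivative is linear in the direction: `∂_{u}η = Σⱼ uⱼ ∂ⱼη`. [folklore] -/
theorem lineDeriv_eq_sum_coord {η : ℝ³ → ℝ} {x : ℝ³} (hη : DifferentiableAt ℝ η x) (w : ℝ³) :
    lineDeriv ℝ η x w = ∑ j, w j * lineDeriv ℝ η x (𝐞 j) := by
  have hw : w = ∑ j, w j • (𝐞 j) := by
    simpa using ((EuclideanSpace.basisFun (Fin 3) ℝ).sum_repr w).symm
  simp_rw [hη.lineDeriv_eq_fderiv]
  conv_lhs => rw [hw]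
  simp [map_sum, map_smul]

/-! ## Pointwise identities -/

/-- `⟨ω, Δω⟩ = Σⱼ ∂ⱼ⟨ω, ∂ⱼω⟩ − |∇ω|²_F` for a `C²` field (`|∇ω|²_F = Σⱼ |∂ⱼω|²`). [folklore] -/
theorem inner_laplacian_eq_sum {ζ : ℝ³ → ℝ³} (hζ : ContDiff ℝ 2 ζ) (x : ℝ³) :
    ⟪ζ x, (Δ ζ) x⟫ =
      ∑ j, fderiv ℝ (fun y => ⟪ζ y, fderiv ℝ ζ y (𝐞 j)⟫) x (𝐞 j) -
        FluidPDE.frobeniusNormSq (fderiv ℝ ζ x) := by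
  rw [FluidPDE.laplacian_eq_sum_fderiv_fderiv (EuclideanSpace.basisFun (Fin 3) ℝ) hζ x,
    FluidPDE.frobeniusNormSq_eq_sum (EuclideanSpace.basisFun (Fin 3) ℝ), inner_sum,
    ← Finset.sum_sub_distrib]
  refine Finset.sum_congr rfl fun j _ => ?_
  simp only [EuclideanSpace.basisFun_apply]
  have hζd : DifferentiableAt ℝ ζ x := (hζ.differentiable (by norm_num)) x
  have hDj : DifferentiableAt ℝ (fun y => fderiv ℝ ζ y (𝐞 j)) x := by
    have h1 : ContDiff ℝ 1 (fderiv ℝ ζ) := hζ.fderiv_right (m := 1) (by norm_num)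
    exact ((h1.differentiable one_ne_zero) x).clm_apply (differentiableAt_const _)
  rw [fderiv_inner_apply ℝ hζd hDj, real_inner_self_eq_norm_sq]
  ring

/-- `⟨ω, Dω(w)⟩ = ½ D(|ω|²)(w)`: the transport term is half a derivative of `|ω|²`. [folklore] -/
theorem inner_fderiv_apply_eq_half_fderiv_norm_sq {ζ : ℝ³ → ℝ³} {x : ℝ³}
    (hζ : DifferentiableAt ℝ ζ x) (w : ℝ³) :
    ⟪ζ x, fderiv ℝ ζ x w⟫ = 1 / 2 * fderiv ℝ (fun y => ‖ζ y‖ ^ 2) x w := by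
  rw [(hζ.hasFDerivAt.norm_sq).fderiv, FunLike.coe_smul, Pi.smul_apply,
    ContinuousLinearMap.comp_apply, innerSL_apply_apply]
  simp only [nsmul_eq_mul, Nat.cast_ofNat]
  ring

/-- Expansion of a linear functional in the standard coordinates of `ℝ³`: `ℓ w = Σⱼ wⱼ ℓ(eⱼ)`. [folklore] -/
theorem clm_real_apply_coord (ℓ : ℝ³ →L[ℝ] ℝ) (w : ℝ³) : ℓ w = ∑ j, w j * ℓ (𝐞 j) := by
  have hw : w = ∑ j, w j • (𝐞 j) := by
    simpa using ((EuclideanSpace.basisFun (Fin 3) ℝ).sum_repr w).symm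
  conv_lhs => rw [hw]
  simp [map_sum, map_smul]

/-- `div U = Σⱼ ∂ⱼUⱼ` in standard coordinates, for `U` differentiable at `x`. [folklore] -/
theorem divergence_eq_sum_fderiv_coord {U : ℝ³ → ℝ³} {x : ℝ³} (hU : DifferentiableAt ℝ U x) :
    VectorCalculus.divergence U x = ∑ j, fderiv ℝ (fun y => U y j) x (𝐞 j) := by
  rw [VectorCalculus.divergence, FluidPDE.trace_eq_sum_coord]
  refine Finset.sum_congr rfl fun j _ => ?_
  have h := ((EuclideanSpace.proj j : ℝ³ →L[ℝ] ℝ).hasFDerivAt.comp x hU.hasFDerivAt).fderiv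
  have hfun : (fun y => U y j) = (EuclideanSpace.proj j : ℝ³ →L[ℝ] ℝ) ∘ U := by
    funext y; rfl
  rw [hfun, h, ContinuousLinearMap.comp_apply]
  rfl

/-! ## Integrability against Lipschitz compactly supported weights -/

section Integrability

variable {η : ℝ³ → ℝ} {C : ℝ≥0}

/-- A continuous function times a continuous compactly supported weight is integrable. [folklore] -/
theorem integrable_mul_of_continuous_of_hasCompactSupport {g : ℝ³ → ℝ} (hg : Continuous g)
    (hηcont : Continuous η) (hηc : HasCompactSupport η) : Integrable fun x => g x * η x :=
  (hg.mul hηcont).integrable_of_hasCompactSupport hηc.mul_left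

/-- A continuous function times the line derivative of a Lipschitz compactly supported weight is
integrable (the line derivative is measurable, bounded by the Lipschitz constant, and vanishes
off the support). [folklore] -/
theorem integrable_mul_lineDeriv {g : ℝ³ → ℝ} (hg : Continuous g) (hη : LipschitzWith C η)
    (hηc : HasCompactSupport η) (v : ℝ³) : Integrable fun x => g x * lineDeriv ℝ η x v := by
  have hK : IsCompact (tsupport η) := hηc
  have hsupp : support (fun x => g x * lineDeriv ℝ η x v) ⊆ tsupport η := by
    intro x hx
    by_contra h
    exact hx (show g x * lineDeriv ℝ η x v = 0 by
      rw [lineDeriv_eq_zero_of_notMem_tsupport h, mul_zero])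
  rw [← integrableOn_iff_integrable_of_support_subset hsupp]
  obtain ⟨B, hB⟩ := hK.exists_bound_of_continuousOn hg.continuousOn
  have hmeas : AEStronglyMeasurable (fun x => g x * lineDeriv ℝ η x v) volume :=
    (hg.measurable.mul (measurable_lineDeriv (𝕜 := ℝ) hη.continuous)).aestronglyMeasurable
  refine Measure.integrableOn_of_bounded (M := max B 0 * (C * ‖v‖)) hK.measure_lt_top.ne hmeas ?_
  refine (ae_restrict_mem measurableSet_closure).mono fun x hx => ?_
  rw [norm_mul]
  exact mul_le_mul ((hB x hx).trans (le_max_left _ _)) (norm_lineDeriv_le_of_lipschitz ℝ hη)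
    (norm_nonneg _) (le_max_right _ _)

end Integrability

/-! ## The enstrophy identity (10.11), dynamic half -/

section Identity

variable {T ν : ℝ} {f u : ℝ → ℝ³ → ℝ³} {p : ℝ → ℝ³ → ℝ}

/-- **The viscous term** (`−Y₁ + Y₃` before Tao's polar-coordinate computation of `Y₃`): for
`ζ ∈ C²` and a Lipschitz compactly supported weight `η`,
`∫ ⟨ζ, Δζ⟩ η = −Σⱼ ∫ ⟨ζ, ∂ⱼζ⟩ ∂ⱼη − ∫ |∇ζ|²_F η`
(one integration by parts per coordinate, derivatives of `η` in the a.e. sense). [cite: Tao2011, §10, proof of Thm. 10.1 (terms Y₁, Y₃)] -/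
theorem integral_inner_laplacian_mul_weight {ζ : ℝ³ → ℝ³} (hζ : ContDiff ℝ 2 ζ) {η : ℝ³ → ℝ}
    {C : ℝ≥0} (hη : LipschitzWith C η) (hηc : HasCompactSupport η) :
    ∫ x, ⟪ζ x, (Δ ζ) x⟫ * η x =
      -(∑ j, ∫ x, ⟪ζ x, fderiv ℝ ζ x (𝐞 j)⟫ * lineDeriv ℝ η x (𝐞 j)) -
        ∫ x, FluidPDE.frobeniusNormSq (fderiv ℝ ζ x) * η x := by
  have hζ1 : ContDiff ℝ 1 ζ := hζ.of_le (by norm_num)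
  have hD1 : ContDiff ℝ 1 (fderiv ℝ ζ) := hζ.fderiv_right (m := 1) (by norm_num)
  -- the `C¹` functions `Gⱼ = ⟨ζ, ∂ⱼζ⟩`
  have hG : ∀ j : Fin 3, ContDiff ℝ 1 fun y => ⟪ζ y, fderiv ℝ ζ y (𝐞 j)⟫ := fun j =>
    hζ1.inner ℝ (hD1.clm_apply contDiff_const)
  have hGc : ∀ j : Fin 3, Continuous fun y => fderiv ℝ (fun y => ⟪ζ y, fderiv ℝ ζ y (𝐞 j)⟫) y (𝐞 j) :=
    fun j => ((hG j).continuous_fderiv one_ne_zero).clm_apply continuous_const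
  have hfrob : Continuous fun x => FluidPDE.frobeniusNormSq (fderiv ℝ ζ x) :=
    FluidPDE.continuous_frobeniusNormSq_fderiv hζ1 one_ne_zero
  -- pointwise identity and splitting of the integral
  have hpt : ∀ x, ⟪ζ x, (Δ ζ) x⟫ * η x =
      (∑ j, fderiv ℝ (fun y => ⟪ζ y, fderiv ℝ ζ y (𝐞 j)⟫) x (𝐞 j) * η x) -
        FluidPDE.frobeniusNormSq (fderiv ℝ ζ x) * η x := fun x => by
    rw [inner_laplacian_eq_sum hζ x, sub_mul, Finset.sum_mul]
  simp_rw [hpt]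
  rw [integral_sub (integrable_finsetSum _ fun j _ =>
      integrable_mul_of_continuous_of_hasCompactSupport (hGc j) hη.continuous hηc)
    (integrable_mul_of_continuous_of_hasCompactSupport hfrob hη.continuous hηc),
    integral_finsetSum _ fun j _ =>
      integrable_mul_of_continuous_of_hasCompactSupport (hGc j) hη.continuous hηc]
  congr 1
  rw [← Finset.sum_neg_distrib]
  refine Finset.sum_congr rfl fun j _ => ?_
  exact integral_fderiv_apply_mul_eq_neg_integral_mul_lineDeriv volume (hG j) hη hηc (𝐞 j)

/-- **The transport term** (`Y₄`): for `ζ, U ∈ C¹` with `div U = 0` and a Lipschitz compactly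
supported weight `η`, `∫ ⟨ζ, (U·∇)ζ⟩ η = −½ ∫ |ζ|² (U·∇η)`
("`(u · ∇)½|ω|²` […] integrating by parts", (10.14); `U·∇η = lineDeriv ℝ η x (U x)` a.e.). [cite: Tao2011, §10, proof of Thm. 10.1 (term Y₄, (10.14))] -/
theorem integral_inner_convect_mul_weight {ζ U : ℝ³ → ℝ³} (hζ : ContDiff ℝ 1 ζ)
    (hU : ContDiff ℝ 1 U) (hdiv : VectorCalculus.IsDivFree U) {η : ℝ³ → ℝ} {C : ℝ≥0}
    (hη : LipschitzWith C η) (hηc : HasCompactSupport η) :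
    ∫ x, ⟪ζ x, FluidPDE.convect U ζ x⟫ * η x = -(1 / 2 * ∫ x, ‖ζ x‖ ^ 2 * lineDeriv ℝ η x (U x)) := by
  -- the `C¹` scalar `N = |ζ|²` and the coordinate functions `Uⱼ`
  have hN : ContDiff ℝ 1 fun y => ‖ζ y‖ ^ 2 := hζ.norm_sq ℝ
  have hNc : Continuous fun y => ‖ζ y‖ ^ 2 := hN.continuous
  have hNd : ∀ j : Fin 3, Continuous fun x => fderiv ℝ (fun y => ‖ζ y‖ ^ 2) x (𝐞 j) := fun j =>
    (hN.continuous_fderiv one_ne_zero).clm_apply continuous_const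
  have hUj : ∀ j : Fin 3, ContDiff ℝ 1 fun y => U y j := fun j =>
    (EuclideanSpace.proj j : ℝ³ →L[ℝ] ℝ).contDiff.comp hU
  have hUjc : ∀ j : Fin 3, Continuous fun y => U y j := fun j => (hUj j).continuous
  -- the weights `wⱼ = Uⱼ η`: Lipschitz with compact support
  have hw : ∀ j : Fin 3, ∃ D : ℝ≥0, LipschitzWith D fun x => U x j * η x := fun j =>
    exists_lipschitzWith_mul_of_contDiff (hUj j) hη hηc
  choose D hD using hw
  have hwc : ∀ j : Fin 3, HasCompactSupport fun x => U x j * η x := fun j => hηc.mul_left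
  -- step 1: `⟨ζ, (U·∇)ζ⟩ η = ½ Σⱼ ∂ⱼN · (Uⱼ η)` pointwise
  have hpt : ∀ x, ⟪ζ x, FluidPDE.convect U ζ x⟫ * η x =
      1 / 2 * ∑ j, fderiv ℝ (fun y => ‖ζ y‖ ^ 2) x (𝐞 j) * (U x j * η x) := by
    intro x
    rw [FluidPDE.convect, inner_fderiv_apply_eq_half_fderiv_norm_sq ((hζ.differentiable one_ne_zero) x),
      clm_real_apply_coord, mul_assoc, Finset.sum_mul]
    congr 1
    exact Finset.sum_congr rfl fun j _ => by ring
  -- step 2: integrate, integrate by parts with the weights `wⱼ`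
  have hI1 : ∀ j : Fin 3, Integrable fun x =>
      fderiv ℝ (fun y => ‖ζ y‖ ^ 2) x (𝐞 j) * (U x j * η x) := fun j =>
    integrable_mul_of_continuous_of_hasCompactSupport (hNd j) ((hUjc j).mul hη.continuous) (hwc j)
  have hI2 : ∀ j : Fin 3, Integrable fun x =>
      ‖ζ x‖ ^ 2 * lineDeriv ℝ (fun x => U x j * η x) x (𝐞 j) := fun j =>
    integrable_mul_lineDeriv hNc (hD j) (hwc j) (𝐞 j)
  simp_rw [hpt]
  rw [integral_const_mul, integral_finsetSum _ fun j _ => hI1 j]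
  have hibp : ∀ j : Fin 3, ∫ x, fderiv ℝ (fun y => ‖ζ y‖ ^ 2) x (𝐞 j) * (U x j * η x) =
      -∫ x, ‖ζ x‖ ^ 2 * lineDeriv ℝ (fun x => U x j * η x) x (𝐞 j) := fun j =>
    integral_fderiv_apply_mul_eq_neg_integral_mul_lineDeriv volume hN (hD j) (hwc j) (𝐞 j)
  simp_rw [hibp]
  rw [Finset.sum_neg_distrib, ← integral_finsetSum _ fun j _ => hI2 j, mul_neg]
  congr 2
  -- step 3: `Σⱼ ∂ⱼ(Uⱼ η) = (div U) η + U·∇η = U·∇η` almost everywhere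
  refine integral_congr_ae ?_
  filter_upwards [hη.ae_differentiableAt (μ := volume)] with x hx
  rw [← Finset.mul_sum]
  congr 1
  have hUd : DifferentiableAt ℝ U x := (hU.differentiable one_ne_zero) x
  have hUjd : ∀ j : Fin 3, DifferentiableAt ℝ (fun y => U y j) x := fun j =>
    ((hUj j).differentiable one_ne_zero) x
  have hterm : ∀ j : Fin 3, lineDeriv ℝ (fun x => U x j * η x) x (𝐞 j) =
      fderiv ℝ (fun y => U y j) x (𝐞 j) * η x + U x j * lineDeriv ℝ η x (𝐞 j) := by
    intro j
    have hd : DifferentiableAt ℝ (fun y => U y j * η y) x := (hUjd j).mul hx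
    rw [hd.lineDeriv_eq_fderiv, fderiv_fun_mul (hUjd j) hx, hx.lineDeriv_eq_fderiv]
    simp only [_root_.add_apply, FunLike.coe_smul, Pi.smul_apply, smul_eq_mul]
    ring
  simp_rw [hterm]
  rw [Finset.sum_add_distrib, ← Finset.sum_mul, ← divergence_eq_sum_fderiv_coord hUd, hdiv x,
    zero_mul, zero_add, lineDeriv_eq_sum_coord hx (U x)]

/-- **Tao 2011, the enstrophy identity (10.11), dynamic half, against a Lipschitz weight.** For a
classical Navier–Stokes solution on the closed slab `[0, T] × ℝ³`, a time `t ∈ [0, T]` and a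
Lipschitz compactly supported weight `η`, the enstrophy production
`∫ ⟨ω, ∂ₜω⟩ η` (`ω = curl u(t)`, `∂ₜω = curl ∂ₜu` with the one-sided slab derivative) equals
`−ν∫|∇ω|²_F η − νΣⱼ∫⟨ω, ∂ⱼω⟩∂ⱼη + ½∫|ω|²(u·∇η) + ∫⟨ω, (ω·∇)u⟩η + ∫⟨ω, curl f⟩η`, i.e.
`−Y₁ + Y₃ + Y₄ + Y₆ + Y₅` in Tao's notation (`ν = 1`; `Y₃` here in the once-integrated form
`−Σⱼ∫⟨ω,∂ⱼω⟩∂ⱼη = −∫∇(½|ω|²)·∇η`, before Tao's polar-coordinate evaluation; derivatives of the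
Lipschitz `η` are line derivatives, defined a.e.). Combined with the kinematic half
`NS.localisedEnstrophy_movingCutoff_sub_eq` (which supplies `−Y₂`) this is (10.11) integrated in
time. [cite: Tao2011, §10, proof of Thm. 10.1 ((10.11))] -/
theorem integral_enstrophyProduction_mul_weight (hT : 0 < T)
    (hsol : FluidPDE.IsClassicalNSSolutionOn (Icc 0 T) ν f u p) {t : ℝ} (ht : t ∈ Icc 0 T)
    {η : ℝ³ → ℝ} {C : ℝ≥0} (hη : LipschitzWith C η) (hηc : HasCompactSupport η) :
    ∫ x, enstrophyProduction T u t x * η x =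
      -(ν * ∫ x, FluidPDE.frobeniusNormSq (fderiv ℝ (FluidPDE.curl (u t)) x) * η x)
      - ν * (∑ j, ∫ x, ⟪FluidPDE.curl (u t) x, fderiv ℝ (FluidPDE.curl (u t)) x (𝐞 j)⟫ *
          lineDeriv ℝ η x (𝐞 j))
      + 1 / 2 * (∫ x, ‖FluidPDE.curl (u t) x‖ ^ 2 * lineDeriv ℝ η x (u t x))
      + (∫ x, ⟪FluidPDE.curl (u t) x, FluidPDE.convect (FluidPDE.curl (u t)) (u t) x⟫ * η x)
      + ∫ x, ⟪FluidPDE.curl (u t) x, FluidPDE.curl (f t) x⟫ * η x := by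
  have hU : UniqueDiffOn ℝ (Icc 0 T) := uniqueDiffOn_Icc hT
  -- regularity of the slice fields
  have hu3 : ContDiff ℝ 3 (u t) := (hsol.contDiff_velocity ht).of_le (by norm_cast)
  have hu1 : ContDiff ℝ 1 (u t) := hu3.of_le (by norm_cast)
  have hω2 : ContDiff ℝ 2 (FluidPDE.curl (u t)) := FluidPDE.contDiff_curl (n := 2) hu3
  have hω1 : ContDiff ℝ 1 (FluidPDE.curl (u t)) := hω2.of_le (by norm_cast)
  have hf1 : ContDiff ℝ 1 (f t) :=
    ((hsol.isSmoothSpaceTimeOn_force hU).contDiff_slice ht).of_le (by norm_cast)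
  have hωc : Continuous (FluidPDE.curl (u t)) := hω1.continuous
  have hΔc : Continuous (Δ (FluidPDE.curl (u t))) := FluidPDE.continuous_laplacian hω2
  have hconv1 : Continuous fun x => FluidPDE.convect (u t) (FluidPDE.curl (u t)) x :=
    (hω1.continuous_fderiv one_ne_zero).clm_apply hu1.continuous
  have hconv2 : Continuous fun x => FluidPDE.convect (FluidPDE.curl (u t)) (u t) x :=
    (hu1.continuous_fderiv one_ne_zero).clm_apply hωc
  have hcf : Continuous (FluidPDE.curl (f t)) := FluidPDE.continuous_curl hf1
  -- the four integrable pieces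
  have iΔ : Integrable fun x => ⟪FluidPDE.curl (u t) x, (Δ (FluidPDE.curl (u t))) x⟫ * η x :=
    integrable_mul_of_continuous_of_hasCompactSupport (hωc.inner hΔc) hη.continuous hηc
  have iT : Integrable fun x => ⟪FluidPDE.curl (u t) x, FluidPDE.convect (u t) (FluidPDE.curl (u t)) x⟫ * η x :=
    integrable_mul_of_continuous_of_hasCompactSupport (hωc.inner hconv1) hη.continuous hηc
  have iS : Integrable fun x => ⟪FluidPDE.curl (u t) x, FluidPDE.convect (FluidPDE.curl (u t)) (u t) x⟫ * η x :=
    integrable_mul_of_continuous_of_hasCompactSupport (hωc.inner hconv2) hη.continuous hηc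
  have iF : Integrable fun x => ⟪FluidPDE.curl (u t) x, FluidPDE.curl (f t) x⟫ * η x :=
    integrable_mul_of_continuous_of_hasCompactSupport (hωc.inner hcf) hη.continuous hηc
  -- the vorticity equation, pointwise
  have hpt : ∀ x, enstrophyProduction T u t x * η x =
      ν * (⟪FluidPDE.curl (u t) x, (Δ (FluidPDE.curl (u t))) x⟫ * η x)
        - ⟪FluidPDE.curl (u t) x, FluidPDE.convect (u t) (FluidPDE.curl (u t)) x⟫ * η x
        + ⟪FluidPDE.curl (u t) x, FluidPDE.convect (FluidPDE.curl (u t)) (u t) x⟫ * η x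
        + ⟪FluidPDE.curl (u t) x, FluidPDE.curl (f t) x⟫ * η x := by
    intro x
    rw [enstrophyProduction_apply, hsol.curl_timeDerivWithin_eq hU ht x, inner_add_right,
      inner_add_right, inner_sub_right, inner_smul_right]
    ring
  simp_rw [hpt]
  have iνΔ : Integrable fun x => ν * (⟪FluidPDE.curl (u t) x, (Δ (FluidPDE.curl (u t))) x⟫ * η x) :=
    iΔ.const_mul ν
  have i2 : Integrable fun x => ν * (⟪FluidPDE.curl (u t) x, (Δ (FluidPDE.curl (u t))) x⟫ * η x)
      - ⟪FluidPDE.curl (u t) x, FluidPDE.convect (u t) (FluidPDE.curl (u t)) x⟫ * η x := iνΔ.sub iT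
  have i3 : Integrable fun x => ν * (⟪FluidPDE.curl (u t) x, (Δ (FluidPDE.curl (u t))) x⟫ * η x)
      - ⟪FluidPDE.curl (u t) x, FluidPDE.convect (u t) (FluidPDE.curl (u t)) x⟫ * η x
      + ⟪FluidPDE.curl (u t) x, FluidPDE.convect (FluidPDE.curl (u t)) (u t) x⟫ * η x := i2.add iS
  rw [integral_add i3 iF, integral_add i2 iS, integral_sub iνΔ iT, integral_const_mul,
    integral_inner_laplacian_mul_weight hω2 hη hηc,
    integral_inner_convect_mul_weight hω1 hu1 (hsol.divFree t ht) hη hηc]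
  ring

end Identity
end Literature.Analysis.FluidPDE

end
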